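import Summits.CriticalPhenomena.PercolationContinuityZ3.Theorems.PercNearOneGluingAdditiveGluingKnLemma2General
import HarnessLib

/-!
# `NoHeavyLowerTail` (stmt-CriticalPhenomena-4575) — monotonicity of Kozma–Nitzan's conditional attachment probability `φ_B`

Support file (prover `prim-lf-7`; `--supports stmt-CriticalPhenomena-4575`).  No definitions, no named facts, no sorries.

For a point set `S`, a block `B ⊆ S` and an observer `o`, KN's `φ_B := μ(o ↔ B | B ↮ S∖B)`.  `GiantKn.phi_mono`: `φ_B ≤ φ_{B'}` for
`B ⊆ B' ⊆ S` (cleared of denominators), from BHK Thms 1.3/1.4 for set sources (`stub_bhkSets`, landed) exactly as KN's Lemma 1: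
adding the separation `{B'∖B ↮ S∖B'}` can only raise `μ(o ↔ B | ·)` (negative correlation of `{o↔B}` with `{B'∖B ↔ S∖B'}` given
`B ↮ S∖B`), and removing the internal separation `{B ↮ B'∖B}` can only raise `μ(o ↔ B' | ·)` (positive correlation given `B' ↮ S∖B'`).
This is the "negative blocks move to the top" step of the top-absorbing k-fold KN theorem (`GiantKn.xzT_of_topAbsorbing`, sequel file);
numerically `φ` is monotone AND block-superadditive on every law tested (prim-lf-7 CANDIDATES batch 8).
[cite: KozmaNitzan2024, Lemma 1 (p. 5), Lemma 2 (p. 6); VandenbergHaggstromKahn2005, Thms. 1.3, 1.4]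
-/

noncomputable section

namespace Summit.CriticalPhenomena.PercolationContinuityZ3.Theorems

open MeasureTheory Set Literature.Probability.LatticeModels Literature.Probability.Percolation
open scoped Classical BigOperators

variable {n : ℕ}

namespace GiantKn

/-- **Monotonicity of KN's conditional attachment probability (PROVED): `φ_B ≤ φ_{B'}` for `B ⊆ B' ⊆ S`**, cleared of denominators:
`μ(B ↮ S∖B, o ↔ B) · μ(B' ↮ S∖B') ≤ μ(B ↮ S∖B) · μ(B' ↮ S∖B', o ↔ B')`, provided the points of `S` are simultaneously separable
with positive probability.  Proof (KN Lemma 1 (i),(ii) for blocks): with `E = B'∖B`, `M' = {B ↮ E, B ↮ S∖B', E ↮ S∖B'}`,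
`φ_B ≤ μ(o↔B | M')` (BHK Thm 1.4: `{o↔B}` and `{E ↔ S∖B'}` are negatively correlated given `B ↮ S∖B`),
`μ(o↔B | M') ≤ μ(o↔B' | M')`, and `μ(o↔B' | M') ≤ φ_{B'}` (BHK Thm 1.3: `{o↔B'}` and `{B ↔ E}` are positively correlated given `B' ↮ S∖B'`).
[cite: KozmaNitzan2024, Lemma 1 (p. 5), Lemma 2 (p. 6); VandenbergHaggstromKahn2005, Thms. 1.3, 1.4] -/
theorem phi_mono (w : Sym2 (Fin n) → unitInterval) (o : Fin n) (S B B' : Finset (Fin n)) (hBB' : B ⊆ B') (hB'S : B' ⊆ S)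
    (hM : 0 < (prodBernoulli w).real {ω : BondConfig (Fin n) | ∀ k ∈ S, ∀ l ∈ S, k ≠ l → ¬ (openGraph ω).Reachable k l}) :
    (prodBernoulli w).real ({ω : BondConfig (Fin n) | ∀ s ∈ B, ∀ t ∈ S \ B, ¬ (openGraph ω).Reachable s t} ∩
          ⋃ s ∈ B, (openConn s o : Set (BondConfig (Fin n)))) *
        (prodBernoulli w).real {ω : BondConfig (Fin n) | ∀ s ∈ B', ∀ t ∈ S \ B', ¬ (openGraph ω).Reachable s t} ≤
      (prodBernoulli w).real {ω : BondConfig (Fin n) | ∀ s ∈ B, ∀ t ∈ S \ B, ¬ (openGraph ω).Reachable s t} *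
        (prodBernoulli w).real ({ω : BondConfig (Fin n) | ∀ s ∈ B', ∀ t ∈ S \ B', ¬ (openGraph ω).Reachable s t} ∩
          ⋃ s ∈ B', (openConn s o : Set (BondConfig (Fin n)))) := by
  set μ := prodBernoulli w with hμ
  set E := B' \ B with hE
  set R' := S \ B' with hR'
  have hBS : B ⊆ S := hBB'.trans hB'S
  have hEsub : E ⊆ S \ B := by
    intro e he; rw [hE, Finset.mem_sdiff] at he; exact Finset.mem_sdiff.2 ⟨hB'S he.1, he.2⟩
  set D : Set (BondConfig (Fin n)) := {ω | ∀ s ∈ B, ∀ t ∈ S \ B, ¬ (openGraph ω).Reachable s t} with hD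
  set D' : Set (BondConfig (Fin n)) := {ω | ∀ s ∈ B', ∀ t ∈ S \ B', ¬ (openGraph ω).Reachable s t} with hD'
  set At : Set (BondConfig (Fin n)) := ⋃ s ∈ B, (openConn s o : Set (BondConfig (Fin n))) with hAt
  set At' : Set (BondConfig (Fin n)) := ⋃ s ∈ B', (openConn s o : Set (BondConfig (Fin n))) with hAt'
  set PC1 : Set (BondConfig (Fin n)) := {ω | ∃ k ∈ E, ∃ j ∈ R', k ≠ j ∧ (openGraph ω).Reachable k j} with hPC1
  set PC2 : Set (BondConfig (Fin n)) := {ω | ∃ k ∈ B, ∃ j ∈ E, k ≠ j ∧ (openGraph ω).Reachable k j} with hPC2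
  -- Step A: BHK 1.4 for (C_B, C_{S∖B}) with F = 1{o ↔ B}, G = 1{E ↔ R'}
  have keyA := stub_bhkSets.2 n w B (S \ B)
    ({C : Set (Sym2 (Fin n)) | ∃ s ∈ B, (openGraph C).Reachable s o}.indicator 1)
    ({C : Set (Sym2 (Fin n)) | ∃ k ∈ E, ∃ j ∈ R', k ≠ j ∧ (openGraph C).Reachable k j}.indicator 1)
    (knThm2_monotone_anyReach B o) (knK_monotone_pairConn E R') Finset.disjoint_sdiff
  simp only [knThm2_anyReach_apply, knK_pairConn_apply (S \ B) E R' hEsub] at keyA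
  have hA := knThm2_setIntegral_indicator w D At PC1
  have hA' := knThm2_setIntegral_indicator w D PC1 PC1
  rw [← hD] at keyA
  rw [hA.1, hA'.1, hA.2] at keyA
  -- keyA : μ D * μ (D ∩ (At ∩ PC1)) ≤ μ (D ∩ At) * μ (D ∩ PC1)
  -- Step C: BHK 1.3 for C_{B'} given B' ↮ R', with F = 1{o ↔ B'}, G = 1{B ↔ E}
  have hX : ∀ s ∈ B', s ∉ (↑(S \ B') : Set (Fin n)) := fun s hs h => by
    rw [Finset.mem_coe, Finset.mem_sdiff] at h; exact h.2 hs
  have keyC := stub_bhkSets.1 n w B' (↑(S \ B') : Set (Fin n))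
    ({C : Set (Sym2 (Fin n)) | ∃ s ∈ B', (openGraph C).Reachable s o}.indicator 1)
    ({C : Set (Sym2 (Fin n)) | ∃ k ∈ B, ∃ j ∈ E, k ≠ j ∧ (openGraph C).Reachable k j}.indicator 1)
    (knThm2_monotone_anyReach B' o) (knK_monotone_pairConn B E) hX
  simp only [knThm2_anyReach_apply, knK_pairConn_apply B' B E hBB'] at keyC
  have eD' : {ω : BondConfig (Fin n) | ∀ s ∈ B', ∀ x ∈ (↑(S \ B') : Set (Fin n)), ¬ (openGraph ω).Reachable s x} = D' := by
    ext ω; simp only [mem_setOf_eq, Finset.mem_coe, hD']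
  rw [eD'] at keyC
  have hC := knThm2_setIntegral_indicator w D' At' PC2
  have hC' := knThm2_setIntegral_indicator w D' PC2 PC2
  rw [hC.1, hC'.1, hC.2] at keyC
  -- keyC : μ (D' ∩ At') * μ (D' ∩ PC2) ≤ μ D' * μ (D' ∩ (At' ∩ PC2))
  -- the common refinement M' = D \ PC1 = D' \ PC2
  have eM : D \ PC1 = D' \ PC2 := by
    ext ω
    simp only [mem_sdiff, hD, hD', hPC1, hPC2, mem_setOf_eq, not_exists, not_and]
    constructor
    · rintro ⟨hDω, hnpc⟩
      refine ⟨fun s hs t ht => ?_, fun k hk j hj hkj hr => ?_⟩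
      · have htS : t ∈ S \ B := Finset.mem_sdiff.2 ⟨(Finset.mem_sdiff.1 ht).1, fun h => (Finset.mem_sdiff.1 ht).2 (hBB' h)⟩
        by_cases hsB : s ∈ B
        · exact hDω s hsB t htS
        · have hsE : s ∈ E := by rw [hE, Finset.mem_sdiff]; exact ⟨hs, hsB⟩
          have htR : t ∈ R' := ht
          intro h
          exact hnpc s hsE t htR (fun hst => (Finset.mem_sdiff.1 ht).2 (hst ▸ hs)) h
      · exact hDω k hk j (hEsub hj) hr
    · rintro ⟨hD'ω, hnpc⟩
      refine ⟨fun s hs t ht => ?_, fun k hk j hj hkj hr => ?_⟩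
      · by_cases htB' : t ∈ B'
        · have htE : t ∈ E := by rw [hE, Finset.mem_sdiff]; exact ⟨htB', (Finset.mem_sdiff.1 ht).2⟩
          intro h
          exact hnpc s hs t htE (fun hst => (Finset.mem_sdiff.1 ht).2 (hst ▸ hs)) h
        · exact hD'ω s (hBB' hs) t (Finset.mem_sdiff.2 ⟨(Finset.mem_sdiff.1 ht).1, htB'⟩)
      · have hkB' : k ∈ B' := (Finset.mem_sdiff.1 (hE ▸ hk : k ∈ B' \ B)).1
        exact hD'ω k hkB' j hj hr
  -- measures of the pieces
  have sA1 : μ.real (D \ PC1) = μ.real D - μ.real (D ∩ PC1) := by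
    have := measureReal_inter_add_sdiff (μ := μ) (s := D) (MeasurableSet.of_discrete (s := PC1)); linarith
  have sA2 : μ.real ((D \ PC1) ∩ At) = μ.real (D ∩ At) - μ.real (D ∩ (At ∩ PC1)) := by
    have := measureReal_inter_add_sdiff (μ := μ) (s := D ∩ At) (MeasurableSet.of_discrete (s := PC1))
    have e : (D ∩ At) \ PC1 = (D \ PC1) ∩ At := by ext ω; simp only [mem_sdiff, mem_inter_iff]; tauto
    have e' : D ∩ At ∩ PC1 = D ∩ (At ∩ PC1) := by rw [inter_assoc]
    rw [e, e'] at this; linarith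
  have sC1 : μ.real (D' \ PC2) = μ.real D' - μ.real (D' ∩ PC2) := by
    have := measureReal_inter_add_sdiff (μ := μ) (s := D') (MeasurableSet.of_discrete (s := PC2)); linarith
  have sC2 : μ.real ((D' \ PC2) ∩ At') = μ.real (D' ∩ At') - μ.real (D' ∩ (At' ∩ PC2)) := by
    have := measureReal_inter_add_sdiff (μ := μ) (s := D' ∩ At') (MeasurableSet.of_discrete (s := PC2))
    have e : (D' ∩ At') \ PC2 = (D' \ PC2) ∩ At' := by ext ω; simp only [mem_sdiff, mem_inter_iff]; tauto
    have e' : D' ∩ At' ∩ PC2 = D' ∩ (At' ∩ PC2) := by rw [inter_assoc]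
    rw [e, e'] at this; linarith
  -- (A) a·μ(M') ≤ d·μ(M' ∩ At) ; (C) μ(M' ∩ At')·d' ≤ μ(M')·a'
  have iA : μ.real (D ∩ At) * μ.real (D \ PC1) ≤ μ.real D * μ.real ((D \ PC1) ∩ At) := by
    rw [sA1, sA2]; nlinarith [keyA]
  have iC : μ.real ((D' \ PC2) ∩ At') * μ.real D' ≤ μ.real (D' \ PC2) * μ.real (D' ∩ At') := by
    rw [sC1, sC2]; nlinarith [keyC]
  -- (B) monotonicity of the attachment
  have iB : μ.real ((D \ PC1) ∩ At) ≤ μ.real ((D \ PC1) ∩ At') := by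
    apply measureReal_mono _ (measure_ne_top _ _)
    intro ω hω
    refine ⟨hω.1, ?_⟩
    have h2 := hω.2
    simp only [hAt, hAt', mem_iUnion, exists_prop] at h2 ⊢
    obtain ⟨s, hs, hso⟩ := h2
    exact ⟨s, hBB' hs, hso⟩
  -- positivity of μ(M')
  have hMpos : 0 < μ.real (D \ PC1) := by
    refine lt_of_lt_of_le hM (measureReal_mono ?_ (measure_ne_top _ _))
    intro ω hω
    simp only [mem_sdiff, hD, hPC1, mem_setOf_eq, not_exists, not_and]
    refine ⟨fun s hs t ht => hω s (hBS hs) t (Finset.mem_sdiff.1 ht).1 (fun h => (Finset.mem_sdiff.1 ht).2 (h ▸ hs)), ?_⟩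
    intro k hk j hj hkj
    exact hω k ((Finset.mem_sdiff.1 (hEsub hk)).1) j (Finset.mem_sdiff.1 hj).1 hkj
  rw [eM] at iA iB hMpos
  -- combine: a d' μ(M') ≤ d μ(M'∩At) d' ≤ d μ(M'∩At') d' ≤ d μ(M') a'
  have hd : 0 ≤ μ.real D := measureReal_nonneg
  have hd' : 0 ≤ μ.real D' := measureReal_nonneg
  have h1 : μ.real (D ∩ At) * μ.real D' * μ.real (D' \ PC2) ≤ μ.real D * μ.real ((D' \ PC2) ∩ At') * μ.real D' := by
    have := mul_le_mul_of_nonneg_right iA hd'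
    have := mul_le_mul_of_nonneg_left iB hd
    nlinarith
  have h2 : μ.real D * μ.real ((D' \ PC2) ∩ At') * μ.real D' ≤ μ.real D * (μ.real (D' \ PC2) * μ.real (D' ∩ At')) := by
    have := mul_le_mul_of_nonneg_left iC hd
    nlinarith
  have h3 : μ.real (D ∩ At) * μ.real D' * μ.real (D' \ PC2) ≤ (μ.real D * μ.real (D' ∩ At')) * μ.real (D' \ PC2) := by
    nlinarith
  exact le_of_mul_le_mul_right h3 hMpos

end GiantKn

end Summit.CriticalPhenomena.PercolationContinuityZ3.Theorems

end
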